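import Literature.Geometry.Lorentzian.PenroseRigidity
import Literature.Geometry.Lorentzian.ExteriorRegionSchwarzschildEnd
import Literature.Geometry.Lorentzian.VolumePositivity
import Literature.Geometry.Lorentzian.VolumeProofs
import HarnessLib

/-!
# `ℰ(∂M', g) = 2m` in the case of equality, from the rigidity conclusion of Bray's Theorem 19
# (the named fact `Bray2001_capacity_eq_of_penrose_eq` reduced to
# `Bray2001_penrose_rigidity_exteriorRegion`)

`PenroseRigidity.lean` vendors two named facts for the case of equality of the Riemannian
Penrose inequality on an exterior region `U` (Bray, J. Differential Geom. 59 (2001), §13):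

* `Bray2001_penrose_rigidity_exteriorRegion` — Thm. 19, case of equality: `U` is isometric to
  the Schwarzschild exterior `({m/2 < ‖y‖}, (1 + m/2‖y‖)⁴ δ)` of mass `m = e.admEnergy D`, by a
  diffeomorphism `Φ` with `Φ^* ((1 + m/2‖y‖)⁴ δ) = h`;
* `Bray2001_capacity_eq_of_penrose_eq` — the step of the proof of the case of equality preceding
  the appeal to Thm. 9: `ℰ(∂M', g) = 2m`, i.e. `(horizonCapacity D.h e U).toReal / 2 = m`.

In the source the second is a step towards the first (§13: (226), the derivative formula of §7,
then the case of equality of Thm. 9). Conversely — and this is what is machine-checked here —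
**the second follows from the first** by the "if" direction of the case of equality of Thm. 9
(*"`m = ½ ℰ(Σ, g)` if and only if `(M³, g)` is isometric to a Schwarzschild metric of mass `m`
outside `Σ`"*): the capacity of the horizon of an exterior region isometric to the
Schwarzschild exterior of mass `m` is `2m`. That direction is proved in the tree
(`horizonCapacity_toReal_div_two_eq_of_diffeomorph_schwarzschild`,
`ExteriorRegionSchwarzschildEnd.lean`: the isometry `Φ` is an end structure of the same end as
`e`, in whose chart the metric has the Schwarzschild components, and the capacity of such an end
is `2m`, `MassCapacitySchwarzschildEnd.lean`), so that:

* `Bray2001_capacity_eq_of_penrose_eq_of_penrose_rigidity_exteriorRegion` —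
  **`Bray2001_penrose_rigidity_exteriorRegion → Bray2001_capacity_eq_of_penrose_eq`**, proved.
  (The mass is positive in the case of equality: `m = √(|Σ₀|/16π)` with `|Σ₀| > 0` for a nonempty
  compact surface, `riemannianVolume_pos_of_isOpen`, and `|Σ₀| < ∞`,
  `riemannianVolume_lt_top_of_isCompact_holds`.)

Consequently every discharge of `Bray2001_penrose_rigidity_exteriorRegion` discharges
`Bray2001_capacity_eq_of_penrose_eq` as well. No definitions and no named facts are introduced.

## References

* H. L. Bray, *Proof of the Riemannian Penrose inequality using the positive mass theorem*,
  J. Differential Geom. 59 (2001) 177–267 (arXiv:math/9911173): §6, Def. 17 and Thm. 9 (case of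
  equality); §13, Thm. 19 and the proof of the case of equality (p. 240). (key `BrayRPI2001`)
-/

noncomputable section

open Set Filter Function MeasureTheory Metric TopologicalSpace Manifold Bundle Bornology
open scoped ENNReal Topology Real Manifold ContDiff

namespace Literature.Geometry.Lorentzian

open PseudoRiemannianMetric

/-- **Thm. 19 (case of equality) implies `ℰ(∂M', g) = 2m`**: the named fact
`Bray2001_penrose_rigidity_exteriorRegion` (Bray 2001, Thm. 19, case of equality, for exterior
regions: an isometry `Φ : U ≅ {m/2 < ‖y‖}` with `Φ^* ((1 + m/2‖y‖)⁴ δ) = h`, `m = e.admEnergy D`)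
implies the named fact `Bray2001_capacity_eq_of_penrose_eq` (`(horizonCapacity D.h e U).toReal / 2
= m`), by the "if" direction of the case of equality of Thm. 9 — the capacity of the horizon of an
exterior region isometric to the Schwarzschild exterior of mass `m` is `2m`
(`horizonCapacity_toReal_div_two_eq_of_diffeomorph_schwarzschild`, with `a = m/2 > 0`: in the
case of equality `m = √(|Σ₀|/16π) > 0`, the nonempty compact surface `Σ₀` having positive finite
area). [cite: BrayRPI2001, §6 Thm. 9 (case of equality) and §13 Thm. 19 (case of equality)] -/
theorem Bray2001_capacity_eq_of_penrose_eq_of_penrose_rigidity_exteriorRegion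
    (hY : Bray2001_penrose_rigidity_exteriorRegion) : Bray2001_capacity_eq_of_penrose_eq := by
  intro X _ _ _ _ _ _ _ _ _ D _ e U B hcomp hU hAF hRq hADM hR hiii S₀ _ _ _ _ _ _ _ f₀ hpb₀ hf₀
    hemb hsub hne heq
  -- the isometry with the Schwarzschild exterior of mass `m = e.admEnergy D`
  obtain ⟨Φ, hΦ⟩ := hY X D e U B hcomp hU hAF hRq hADM hR hiii S₀ f₀ hpb₀ hf₀ hemb hsub hne heq
  -- `m > 0`: the area of the nonempty compact surface `Σ₀` is positive and finite
  haveI : Nonempty S₀ := hne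
  set h₀ := (ofRiemannian D.h).inducedRiemannianMetric f₀ hpb₀ hf₀ with hh₀
  have hA : totalArea h₀ = riemannianVolume h₀ (Module.finrank ℝ (EuclideanSpace ℝ (Fin 2)))
      univ := by
    simp only [totalArea, area_eq, finrank_euclideanSpace_fin]
  have hApos : 0 < totalArea h₀ := by
    rw [hA]
    exact riemannianVolume_pos_of_isOpen h₀ isOpen_univ univ_nonempty
  have hAfin : totalArea h₀ < ⊤ := by
    rw [hA]
    exact riemannianVolume_lt_top_of_isCompact_holds h₀ le_rfl isCompact_univ
  have hm0 : 0 < e.admEnergy D := by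
    rw [← heq]
    exact Real.sqrt_pos.2 (div_pos (ENNReal.toReal_pos hApos.ne' hAfin.ne) (by positivity))
  have ha : 0 < e.admEnergy D / 2 := by positivity
  -- the Schwarzschild factor `1 + m/(2‖y‖) = 1 + (m/2)/‖y‖`
  have hΦ' : ∀ x : U, pullbackBilin (I := 𝓡 3) (I' := 𝓡 3) Φ
      (fun y ↦ (1 + e.admEnergy D / 2 / ‖(y : E3)‖) ^ 4 •
        (innerSL ℝ (E := E3) : E3 →L[ℝ] E3 →L[ℝ] ℝ)) x = D.metric.val x.1 := by
    intro x
    simp only [div_div]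
    exact hΦ x
  -- the capacity of the horizon of the Schwarzschild end of mass `m = 2 (m/2)`
  rw [horizonCapacity_toReal_div_two_eq_of_diffeomorph_schwarzschild Φ ha one_pos
    hAF hU hΦ']
  ring

end Literature.Geometry.Lorentzian

end
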